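import Summits.AnomalousDissipation.AnomalousDissipation.Theorems.SawtoothPulseCascadeK1LocalisedCascadeCornerTraceTerm

/-!
# K1loc — helper: THE ALL-ORDERS CORNER-TRACE ESTIMATE, PER FREQUENCY («CT-GEO» 1/4)

Helper file of the prover lane on the crux `K1LocalisedCascade` (stmt-AnomalousDissipation-19491), route
`SawtoothPulseCascade` (S-D fibre ledger, corner-trace track; finding F-p1g9-1, memo v15).  `…CornerTraceTerm.cornerTrace_term_sq_le`
expands the resolvent `1/(λ ± (k−l))` of the exact `N`-tooth chirp to FIRST order and bounds the remainder by Cauchy–Schwarz on the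
residue class, which produces the residue term `12N²L²Mσ/(π²D²)·E` of `…CornerTraceSum` (the `β*` of the CTE chain).  Here the
resolvent is expanded to an ARBITRARY order `p`: every order is again a residue-class sum — of the coefficients `c_l·l^i`, i.e. of the
trigonometric polynomial `T_i = Σ c_l l^i e_l = T^{(i)}/(2πi)^i`, whose squares add up to corner traces of `T_i` exactly as for `i = 0` —
and only the order-`p` remainder is bounded crudely:
* `one_div_sub_eq_geom_sum` — `1/(a−l) = Σ_{i<p} l^i/a^{i+1} + l^p/(a^p(a−l))`;
* **`cornerTraceGeom_term_le`** — for `|k| + L + D ≤ λ`: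
  `‖Σ_l c_l ĝ₀(k−l)‖ ≤ (N/2π)·(Σ_{i<p} Φ_i(k)(‖A_i⁻(k)‖ + ‖A_i⁺(k)‖) + 2ξ_p(k)·Σ_{l≡k}‖c_l‖|l|^p)`,
  `Φ_i(k) = 1/(λ+k)^{i+1} + 1/(λ−k)^{i+1}`, `ξ_p(k) = (1/D)(1/(λ+k)^p + 1/(λ−k)^p)`, `A_i^∓(k) = Σ_{l∈S, N∣k−l} c_l l^i e^{∓iπl/(2N)}`.
The window sum (Cauchy–Schwarz weights `Λ^i`, finite Parseval) is `…CornerTraceGeomSum`.  No definitions; nothing about the crux.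
[cite: Grafakos2014, Prop. 3.1.2 (5), §3.1.3] [problem: turb]
-/

-- `Summit.<Summit>.<Problem>`: single-conjunct summit, the duplicate namespace segment is deliberate.
set_option linter.dupNamespace false

noncomputable section

namespace Summit.AnomalousDissipation.AnomalousDissipation.Theorems.SawtoothPulseCascade.K1Window

open MeasureTheory Set Filter Topology Function Complex AddCircle
open scoped Real
open Literature.Analysis Literature.Analysis.FunctionSpaces Literature.Analysis.FunctionSpaces.Torus Literature.Analysis.FluidPDE
open Literature.Analysis.FluidPDE.SawtoothCascade
open Summit.AnomalousDissipation.AnomalousDissipation.Theorems.SawtoothPulseCascade.K1Start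

/-! ## §1 The finite geometric expansion of the resolvent -/

/-- **Finite geometric expansion**: for complex `a, l` with `a ≠ 0`, `a − l ≠ 0` and every `p`,
`1/(a − l) = Σ_{i<p} l^i/a^{i+1} + l^p/(a^p(a − l))`. [folklore] -/
theorem one_div_sub_eq_geom_sum (a l : ℂ) (ha : a ≠ 0) (hal : a - l ≠ 0) (p : ℕ) :
    1 / (a - l) = ∑ i ∈ Finset.range p, l ^ i / a ^ (i + 1) + l ^ p / (a ^ p * (a - l)) := by
  induction p with
  | zero => simp
  | succ p ih =>
    rw [Finset.sum_range_succ, ih, add_assoc]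
    congr 1
    have hap : a ^ p ≠ 0 := pow_ne_zero _ ha
    have hap1 : a ^ (p + 1) ≠ 0 := pow_ne_zero _ ha
    field_simp
    ring

/-- The same with the opposite sign: `1/(b + l) = Σ_{i<p} (−l)^i/b^{i+1} + (−l)^p/(b^p(b + l))`. [folklore] -/
theorem one_div_add_eq_geom_sum (b l : ℂ) (hb : b ≠ 0) (hbl : b + l ≠ 0) (p : ℕ) :
    1 / (b + l) = ∑ i ∈ Finset.range p, (-l) ^ i / b ^ (i + 1) + (-l) ^ p / (b ^ p * (b + l)) := by
  have h := one_div_sub_eq_geom_sum b (-l) hb (by rwa [sub_neg_eq_add]) p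
  rwa [sub_neg_eq_add] at h

/-! ## §2 The per-frequency estimate at order `p` -/

set_option maxHeartbeats 800000 in
/-- **Per-frequency all-orders corner-trace estimate.**  `N ≥ 1`, lobe `λ = L₂`, `g₀` the exact `N`-tooth chirp with lobe `λ`,
coefficients `c` on a finite `S` with `|l| ≤ L`, window `W` with `|k| + L + D ≤ L₂` (`D ≥ 1`), order `p`.  For every `k ∈ W`,
`‖Σ_{l∈S} c_l ĝ₀(k−l)‖ ≤ (N/(2π))·(Σ_{i<p} (1/(λ+k)^{i+1} + 1/(λ−k)^{i+1})·(‖A_i⁻(k)‖ + ‖A_i⁺(k)‖)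
  + 2·((1/(λ+k)^p + 1/(λ−k)^p)/D)·Σ_{l∈S, N∣k−l} ‖c_l‖·|l|^p)`,
`A_i^∓(k) = Σ_{l∈S, N∣k−l} c_l l^i e^{∓iπl/(2N)}`: the closed form of `ĝ₀` (`…CornerTraceTerm`), the expansion
`1/(λ±(k−l)) = Σ_{i<p} (±l)^i/(λ±k)^{i+1} + remainder`, `|remainder| ≤ |l|^p/((λ±k)^p·D)`.
[cite: Grafakos2014, Prop. 3.1.2 (5), §3.1.3] -/
theorem cornerTraceGeom_term_le {N : ℕ} (hN : 0 < N) {L₂ : ℕ} {g₀ : UnitAddCircle → ℂ}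
    (hg₀ : ∀ t : ℝ, g₀ (t : UnitAddCircle) =
      Complex.exp (-(2 * π * I * ((L₂ : ℤ) : ℂ) * ((tri (2 * π * N * t) / (2 * π * N) : ℝ) : ℂ))))
    (c : ℤ → ℂ) (S : Finset ℤ) {L D : ℕ} (hD : 0 < D) (hS : ∀ l ∈ S, |l| ≤ L)
    (W : Finset ℤ) (hW : ∀ k ∈ W, |k| + L + D ≤ (L₂ : ℤ)) (p : ℕ) :
    ∀ k ∈ W, ‖∑ l ∈ S, c l * fourierCoeff g₀ (k - l)‖ ≤
      (N : ℝ) / (2 * π) *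
        (∑ i ∈ Finset.range p, (1 / ((L₂ : ℝ) + k) ^ (i + 1) + 1 / ((L₂ : ℝ) - k) ^ (i + 1)) *
            (‖∑ l ∈ S.filter (fun l => (N : ℤ) ∣ k - l), c l * (l : ℂ) ^ i * Complex.exp (-(π * I * l / (2 * N)))‖ +
              ‖∑ l ∈ S.filter (fun l => (N : ℤ) ∣ k - l), c l * (l : ℂ) ^ i * Complex.exp (π * I * l / (2 * N))‖) +
          2 * ((1 / ((L₂ : ℝ) + k) ^ p + 1 / ((L₂ : ℝ) - k) ^ p) / D) *
            ∑ l ∈ S.filter (fun l => (N : ℤ) ∣ k - l), ‖c l‖ * |(l : ℝ)| ^ p) := by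
  classical
  have hπ : 0 < π := Real.pi_pos
  have hNr : (0 : ℝ) < N := by exact_mod_cast hN
  have hDr : (0 : ℝ) < D := by exact_mod_cast hD
  -- positivity of the distances on the window
  have hdist : ∀ k ∈ W, ∀ l ∈ S, ((D : ℝ) + L ≤ (L₂ : ℝ) + k ∧ (D : ℝ) + L ≤ (L₂ : ℝ) - k) ∧
      ((D : ℝ) ≤ (L₂ : ℝ) + (k - l) ∧ (D : ℝ) ≤ (L₂ : ℝ) - (k - l)) := by
    intro k hk l hl
    have h1 := hW k hk
    have h2 := hS l hl
    have h1' : (|k| : ℝ) + L + D ≤ L₂ := by exact_mod_cast h1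
    have h2' : (|l| : ℝ) ≤ L := by exact_mod_cast h2
    rw [← Int.cast_abs] at h1' h2'
    refine ⟨⟨?_, ?_⟩, ?_, ?_⟩ <;> [skip; skip; skip; skip] <;>
      (have := le_abs_self ((k : ℤ) : ℝ); have := neg_abs_le ((k : ℤ) : ℝ);
       have := le_abs_self ((l : ℤ) : ℝ); have := neg_abs_le ((l : ℤ) : ℝ); push_cast at *; linarith)
  -- the corner phases
  set E : ℂ := Complex.exp (π * I * (L₂ : ℤ) / (2 * N)) with hE
  set E' : ℂ := Complex.exp (-(π * I * (L₂ : ℤ) / (2 * N))) with hE'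
  set ω : ℤ → ℂ := fun x => Complex.exp (π * I * x / (2 * N)) with hω
  set ω' : ℤ → ℂ := fun x => Complex.exp (-(π * I * x / (2 * N))) with hω'
  have hEn : ‖E‖ = 1 := by
    rw [hE, show (π * I * ((L₂ : ℤ) : ℂ) / (2 * N) : ℂ) = ((π * L₂ / (2 * N) : ℝ) : ℂ) * I by push_cast; ring,
      Complex.norm_exp_ofReal_mul_I]
  have hE'n : ‖E'‖ = 1 := by
    rw [hE', show (-(π * I * ((L₂ : ℤ) : ℂ) / (2 * N)) : ℂ) = ((-(π * L₂ / (2 * N)) : ℝ) : ℂ) * I by push_cast; ring,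
      Complex.norm_exp_ofReal_mul_I]
  have hωn : ∀ x, ‖ω x‖ = 1 := fun x => by
    rw [hω]; simp only
    rw [show (π * I * (x : ℂ) / (2 * N) : ℂ) = ((π * x / (2 * N) : ℝ) : ℂ) * I by push_cast; ring, Complex.norm_exp_ofReal_mul_I]
  have hω'n : ∀ x, ‖ω' x‖ = 1 := fun x => by
    rw [hω']; simp only
    rw [show (-(π * I * (x : ℂ) / (2 * N)) : ℂ) = ((-(π * x / (2 * N)) : ℝ) : ℂ) * I by push_cast; ring,
      Complex.norm_exp_ofReal_mul_I]
  -- real kernel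
  set Φ : ℤ → ℤ → ℝ := fun k l => (N : ℝ) / (π * ((L₂ : ℝ) + (k - l))) + (N : ℝ) / (π * ((L₂ : ℝ) - (k - l))) with hΦ
  -- the per-`k` residue set
  set Sk : ℤ → Finset ℤ := fun k => S.filter fun l => (N : ℤ) ∣ k - l with hSk
  -- Step 1: the term-wise closed form, `X(k) = (1/(2i)) Σ_{l∈S_k} c_l Φ(k,l) (E ω_k ω̄_l − Ē ω̄_k ω_l)`
  have hX : ∀ k ∈ W, ∑ l ∈ S, c l * fourierCoeff g₀ (k - l) =
      (1 / (2 * I)) * ∑ l ∈ Sk k, c l * (Φ k l : ℂ) * (E * ω k * ω' l - E' * ω' k * ω l) := by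
    intro k hk
    rw [Finset.mul_sum]
    rw [← Finset.sum_filter_add_sum_filter_not S (fun l => (N : ℤ) ∣ k - l)]
    have hzero : ∑ l ∈ S.filter (fun l => ¬ (N : ℤ) ∣ k - l), c l * fourierCoeff g₀ (k - l) = 0 := by
      refine Finset.sum_eq_zero fun l hl => ?_
      obtain ⟨hlS, hndvd⟩ := Finset.mem_filter.mp hl
      obtain ⟨-, h3, h4⟩ := hdist k hk l hlS
      rw [fourierCoeff_nTooth_exactChirp hN (L₂ : ℤ) hg₀ (m := k - l)
        (by intro h0; have : ((L₂ : ℝ) + (k - l)) = 0 := by exact_mod_cast h0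
            linarith)
        (by intro h0; have : ((L₂ : ℝ) - (k - l)) = 0 := by exact_mod_cast h0
            linarith), if_neg hndvd, mul_zero]
    rw [hzero, add_zero]
    refine Finset.sum_congr rfl fun l hl => ?_
    obtain ⟨hlS, hdvd⟩ := Finset.mem_filter.mp hl
    obtain ⟨-, h3, h4⟩ := hdist k hk l hlS
    rw [fourierCoeff_nTooth_exactChirp hN (L₂ : ℤ) hg₀ (m := k - l)
      (by intro h0; have : ((L₂ : ℝ) + (k - l)) = 0 := by exact_mod_cast h0
          linarith)
      (by intro h0; have : ((L₂ : ℝ) - (k - l)) = 0 := by exact_mod_cast h0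
          linarith), if_pos hdvd]
    rw [Complex.ofReal_mul, ofReal_sin_corner N (L₂ : ℤ) k l]
    simp only [hΦ, hE, hE', hω, hω']
    push_cast
    field_simp
  -- Step 2: the order-`p` expansion of `Φ(k,l)` (in `ℂ`)
  intro k hk
  obtain ⟨⟨hk1, hk2⟩, -⟩ : ((D : ℝ) + L ≤ (L₂ : ℝ) + k ∧ (D : ℝ) + L ≤ (L₂ : ℝ) - k) ∧ True := by
    by_cases hS0 : S.Nonempty
    · obtain ⟨l, hl⟩ := hS0
      exact ⟨(hdist k hk l hl).1, trivial⟩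
    · have h1 := hW k hk
      have h1' : (|k| : ℝ) + L + D ≤ L₂ := by exact_mod_cast h1
      rw [← Int.cast_abs] at h1'
      have := le_abs_self ((k : ℤ) : ℝ); have := neg_abs_le ((k : ℤ) : ℝ)
      exact ⟨⟨by push_cast at *; linarith, by push_cast at *; linarith⟩, trivial⟩
  have hL0 : (0 : ℝ) ≤ L := Nat.cast_nonneg _
  have hapos : 0 < (L₂ : ℝ) + k := by linarith
  have hbpos : 0 < (L₂ : ℝ) - k := by linarith
  set a : ℂ := (((L₂ : ℝ) + k : ℝ) : ℂ) with ha
  set b : ℂ := (((L₂ : ℝ) - k : ℝ) : ℂ) with hb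
  have ha0 : a ≠ 0 := by rw [ha]; exact_mod_cast hapos.ne'
  have hb0 : b ≠ 0 := by rw [hb]; exact_mod_cast hbpos.ne'
  -- the signed kernels `Φ_i(k)` and the remainder `Ξ(k,l)`
  set Φs : ℕ → ℂ := fun i => 1 / a ^ (i + 1) + (-1) ^ i / b ^ (i + 1) with hΦs
  set Ξ : ℤ → ℂ := fun l => 1 / (a ^ p * (a - l)) + (-1) ^ p / (b ^ p * (b + l)) with hΞ
  have hexp : ∀ l ∈ Sk k, (Φ k l : ℂ) = (N : ℂ) / π * (∑ i ∈ Finset.range p, (l : ℂ) ^ i * Φs i + (l : ℂ) ^ p * Ξ l) := by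
    intro l hl
    have hlS : l ∈ S := (Finset.mem_filter.mp hl).1
    obtain ⟨-, h3, h4⟩ := hdist k hk l hlS
    have hal : a - l ≠ 0 := by
      rw [ha]; intro h0
      have : ((L₂ : ℝ) + k - l : ℝ) = 0 := by
        have := congrArg Complex.re h0; simpa using this
      linarith
    have hbl : b + l ≠ 0 := by
      rw [hb]; intro h0
      have : ((L₂ : ℝ) - k + l : ℝ) = 0 := by
        have := congrArg Complex.re h0; simpa using this
      linarith
    have e1 := one_div_sub_eq_geom_sum a l ha0 hal p
    have e2 := one_div_add_eq_geom_sum b l hb0 hbl p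
    have hΦc : (Φ k l : ℂ) = (N : ℂ) / π * (1 / (a - l) + 1 / (b + l)) := by
      simp only [hΦ, ha, hb]; push_cast
      have hπc : (π : ℂ) ≠ 0 := by exact_mod_cast hπ.ne'
      field_simp
      ring
    rw [hΦc, e1, e2]
    congr 1
    have hsum : ∑ i ∈ Finset.range p, (l : ℂ) ^ i * Φs i =
        ∑ i ∈ Finset.range p, (l : ℂ) ^ i / a ^ (i + 1) + ∑ i ∈ Finset.range p, (-(l : ℂ)) ^ i / b ^ (i + 1) := by
      rw [← Finset.sum_add_distrib]
      refine Finset.sum_congr rfl fun i _ => ?_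
      simp only [hΦs]
      rw [neg_pow]; ring
    rw [hsum]
    simp only [hΞ]
    rw [neg_pow]; ring
  -- the residue-class sums of order `i`
  set A : ℕ → ℂ := fun i => ∑ l ∈ Sk k, c l * (l : ℂ) ^ i * ω' l with hA
  set A' : ℕ → ℂ := fun i => ∑ l ∈ Sk k, c l * (l : ℂ) ^ i * ω l with hA'
  -- Step 3: regroup `X(k)`
  have hregroup : ∑ l ∈ Sk k, c l * (Φ k l : ℂ) * (E * ω k * ω' l - E' * ω' k * ω l) =
      (N : ℂ) / π * (∑ i ∈ Finset.range p, Φs i * (E * ω k * A i - E' * ω' k * A' i) +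
        ∑ l ∈ Sk k, c l * (l : ℂ) ^ p * Ξ l * (E * ω k * ω' l - E' * ω' k * ω l)) := by
    have step : ∀ l ∈ Sk k, c l * (Φ k l : ℂ) * (E * ω k * ω' l - E' * ω' k * ω l) =
        (N : ℂ) / π * (∑ i ∈ Finset.range p, Φs i * (E * ω k * (c l * (l : ℂ) ^ i * ω' l) -
          E' * ω' k * (c l * (l : ℂ) ^ i * ω l)) +
          c l * (l : ℂ) ^ p * Ξ l * (E * ω k * ω' l - E' * ω' k * ω l)) := by
      intro l hl
      rw [hexp l hl]
      have hs : ∑ i ∈ Finset.range p, Φs i * (E * ω k * (c l * (l : ℂ) ^ i * ω' l) -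
          E' * ω' k * (c l * (l : ℂ) ^ i * ω l)) =
          (∑ i ∈ Finset.range p, (l : ℂ) ^ i * Φs i) * (c l * (E * ω k * ω' l - E' * ω' k * ω l)) := by
        rw [Finset.sum_mul]
        refine Finset.sum_congr rfl fun i _ => ?_
        ring
      rw [hs]
      ring
    rw [Finset.sum_congr rfl step, ← Finset.mul_sum, Finset.sum_add_distrib, Finset.sum_comm]
    congr 2
    refine Finset.sum_congr rfl fun i _ => ?_
    simp only [hA, hA', Finset.mul_sum, ← Finset.sum_sub_distrib]
  -- Step 4: norms
  have hΦs_norm : ∀ i, ‖Φs i‖ ≤ 1 / ((L₂ : ℝ) + k) ^ (i + 1) + 1 / ((L₂ : ℝ) - k) ^ (i + 1) := by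
    intro i
    simp only [hΦs]
    refine (norm_add_le _ _).trans (add_le_add ?_ ?_)
    · rw [ha, norm_div, norm_one, norm_pow, Complex.norm_real, Real.norm_eq_abs, abs_of_pos hapos]
    · rw [hb, norm_div, norm_pow, norm_neg, norm_one, one_pow, norm_pow, Complex.norm_real, Real.norm_eq_abs,
        abs_of_pos hbpos]
  have hΞ_norm : ∀ l ∈ Sk k, ‖Ξ l‖ ≤ (1 / ((L₂ : ℝ) + k) ^ p + 1 / ((L₂ : ℝ) - k) ^ p) / D := by
    intro l hl
    have hlS : l ∈ S := (Finset.mem_filter.mp hl).1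
    obtain ⟨-, h3, h4⟩ := hdist k hk l hlS
    simp only [hΞ]
    refine (norm_add_le _ _).trans ?_
    rw [add_div]
    refine add_le_add ?_ ?_
    · rw [norm_div, norm_one, norm_mul, norm_pow, ha]
      have e1 : ‖(((L₂ : ℝ) + k : ℝ) : ℂ) - (l : ℂ)‖ = (L₂ : ℝ) + (k - l) := by
        rw [show ((((L₂ : ℝ) + k : ℝ) : ℂ) - (l : ℂ)) = (((L₂ : ℝ) + (k - l) : ℝ) : ℂ) by push_cast; ring,
          Complex.norm_real, Real.norm_eq_abs, abs_of_pos (by linarith)]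
      rw [e1, Complex.norm_real, Real.norm_eq_abs, abs_of_pos hapos, div_div]
      exact one_div_le_one_div_of_le (by positivity) (mul_le_mul_of_nonneg_left h3 (by positivity))
    · rw [norm_div, norm_pow, norm_neg, norm_one, one_pow, norm_mul, norm_pow, hb]
      have e1 : ‖(((L₂ : ℝ) - k : ℝ) : ℂ) + (l : ℂ)‖ = (L₂ : ℝ) - (k - l) := by
        rw [show ((((L₂ : ℝ) - k : ℝ) : ℂ) + (l : ℂ)) = (((L₂ : ℝ) - (k - l) : ℝ) : ℂ) by push_cast; ring,
          Complex.norm_real, Real.norm_eq_abs, abs_of_pos (by linarith)]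
      rw [e1, Complex.norm_real, Real.norm_eq_abs, abs_of_pos hbpos, div_div]
      exact one_div_le_one_div_of_le (by positivity) (mul_le_mul_of_nonneg_left h4 (by positivity))
  have hmain_norm : ‖∑ i ∈ Finset.range p, Φs i * (E * ω k * A i - E' * ω' k * A' i)‖ ≤
      ∑ i ∈ Finset.range p, (1 / ((L₂ : ℝ) + k) ^ (i + 1) + 1 / ((L₂ : ℝ) - k) ^ (i + 1)) * (‖A i‖ + ‖A' i‖) := by
    refine (norm_sum_le _ _).trans (Finset.sum_le_sum fun i _ => ?_)
    rw [norm_mul]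
    refine mul_le_mul (hΦs_norm i) ((norm_sub_le _ _).trans (add_le_add ?_ ?_)) (norm_nonneg _) (by positivity)
    · rw [norm_mul, norm_mul, hEn, hωn, one_mul, one_mul]
    · rw [norm_mul, norm_mul, hE'n, hω'n, one_mul, one_mul]
  have hrem_norm : ‖∑ l ∈ Sk k, c l * (l : ℂ) ^ p * Ξ l * (E * ω k * ω' l - E' * ω' k * ω l)‖ ≤
      2 * ((1 / ((L₂ : ℝ) + k) ^ p + 1 / ((L₂ : ℝ) - k) ^ p) / D) * ∑ l ∈ Sk k, ‖c l‖ * |(l : ℝ)| ^ p := by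
    rw [Finset.mul_sum]
    refine (norm_sum_le _ _).trans (Finset.sum_le_sum fun l hl => ?_)
    have h2 : ‖E * ω k * ω' l - E' * ω' k * ω l‖ ≤ 2 := by
      refine (norm_sub_le _ _).trans ?_
      rw [norm_mul, norm_mul, norm_mul, norm_mul, hEn, hωn, hω'n, hE'n, hω'n, hωn]; norm_num
    rw [norm_mul, norm_mul, norm_mul, norm_pow, Complex.norm_intCast]
    have h0 : 0 ≤ ‖c l‖ * |(l : ℝ)| ^ p := by positivity
    calc ‖c l‖ * |(l : ℝ)| ^ p * ‖Ξ l‖ * ‖E * ω k * ω' l - E' * ω' k * ω l‖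
        ≤ ‖c l‖ * |(l : ℝ)| ^ p * (((1 / ((L₂ : ℝ) + k) ^ p + 1 / ((L₂ : ℝ) - k) ^ p) / D)) * 2 :=
          mul_le_mul (mul_le_mul_of_nonneg_left (hΞ_norm l hl) h0) h2 (norm_nonneg _) (by positivity)
      _ = 2 * ((1 / ((L₂ : ℝ) + k) ^ p + 1 / ((L₂ : ℝ) - k) ^ p) / D) * (‖c l‖ * |(l : ℝ)| ^ p) := by ring
  -- assemble
  rw [hX k hk, hregroup, norm_mul, norm_mul]
  have h2I : ‖(1 / (2 * I) : ℂ)‖ = 1 / 2 := by simp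
  have hNπ : ‖((N : ℂ) / π)‖ = (N : ℝ) / π := by
    rw [norm_div, Complex.norm_natCast, Complex.norm_real, Real.norm_eq_abs, abs_of_pos hπ]
  rw [h2I, hNπ]
  have hA_eq : ∀ i, A i = ∑ l ∈ S.filter (fun l => (N : ℤ) ∣ k - l), c l * (l : ℂ) ^ i * Complex.exp (-(π * I * l / (2 * N))) :=
    fun i => rfl
  have hA'_eq : ∀ i, A' i = ∑ l ∈ S.filter (fun l => (N : ℤ) ∣ k - l), c l * (l : ℂ) ^ i * Complex.exp (π * I * l / (2 * N)) :=
    fun i => rfl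
  simp only [← hA_eq, ← hA'_eq]
  calc 1 / 2 * ((N : ℝ) / π * ‖∑ i ∈ Finset.range p, Φs i * (E * ω k * A i - E' * ω' k * A' i) +
        ∑ l ∈ Sk k, c l * (l : ℂ) ^ p * Ξ l * (E * ω k * ω' l - E' * ω' k * ω l)‖)
      ≤ 1 / 2 * ((N : ℝ) / π * (∑ i ∈ Finset.range p, (1 / ((L₂ : ℝ) + k) ^ (i + 1) + 1 / ((L₂ : ℝ) - k) ^ (i + 1)) *
          (‖A i‖ + ‖A' i‖) + 2 * ((1 / ((L₂ : ℝ) + k) ^ p + 1 / ((L₂ : ℝ) - k) ^ p) / D) *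
            ∑ l ∈ Sk k, ‖c l‖ * |(l : ℝ)| ^ p)) := by
        refine mul_le_mul_of_nonneg_left (mul_le_mul_of_nonneg_left
          ((norm_add_le _ _).trans (add_le_add hmain_norm hrem_norm)) (by positivity)) (by norm_num)
    _ = _ := by ring

end Summit.AnomalousDissipation.AnomalousDissipation.Theorems.SawtoothPulseCascade.K1Window
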